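import Summits.QuantumFields.BalabanUV.T4Continuum.Spine.NE2.CovariantTableBalabanTwoLevel
import Mathlib.Analysis.SpecialFunctions.Complex.Log
import Mathlib.Analysis.SpecialFunctions.Trigonometric.Bounds

/-!
# T⁴ programme, spine node NE2 (U1a) — R14 W2, LOCATED NEGATIVE FACE: the SUP-form two-level consistency of Bałaban's composed table FAILS at every geometric rate,
# for contractive, perfectly level-consistent, flat ABELIAN data with (3.35)-sized bond variables (sizes alone do not control the carry cascade in sup norm)
# (cell `pub-balaban-gaps`, seat ne2 gen 4; census `run/shared/lean/pub/pub-balaban-gaps/ne/NE2.md` §12 (b)/(f))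

W1's `CovariantTableTower.tierB_table_rate_at_one` asks the table tower for the SUP-form two-level consistency
`hT2 : ∀ k y μ j r t′ (t′ < L·L^k), ‖T_{k+1}(y, L·j + r, μ, t′) − T_k(y, j, μ, ⌊(r_μ + t′)/L⌋)‖ ≤ θ_k` with `θ_k ≤ θ₀·L^{−k}`.  THIS FILE shows that for `T_k = TBal (W) k` this
CANNOT be supplied from the data letters of file 5's END (contractive values, sizes `‖W_i − 1‖ ≤ α/L^i`, consistency across the two problems — here even `W′ = W`): for the constant
abelian data `W_i ≡ exp(i·ε_i·φ·L^{−i})·1`, `ε_1 = −1`, `ε_i = +1` (`i ≠ 1`) — every plaquette trivial, every bond within `φ·L^{−i}` of `1` — the IN-RANGE entry of carry depth `k − 1`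
(`j = 0`, `r = (L−1)·e_μ`, `t′ = L·(L^{k−1} − 1) + 1`, `k ≥ 2`) has two-level defect EXACTLY `‖exp(2iφ/L) − 1‖`, independent of `k` (**`TBal_sup_defect_eq`**); hence no `θ₀` with
`θ_k ≤ θ₀L^{−k}` exists (**`not_sup_consistency_TBal`**).  The failure is the AXIAL INCONSISTENCY between level `1` and the finer levels (the composed chain of the fine pair runs
`L−1` steps at each level `2,…,k` and `L` steps at level `k+1` — phase `+φ/L` —, the chain of its geometric parent runs ONE step at level `1` — phase `−φ/L`), which sizes and
cross-problem consistency do not see; the MEAN over the line position is nevertheless `O((k+1)·α·L^{−k})` (files 3–5), which is why the END of file 5 reads the mean currency.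
HONEST FRAMING (T4-DAG p. 1).  A kernel counterexample about TYPED tables for toy abelian DATA; it refutes a CURRENCY (the sup-form hypothesis for the composed table under sizes-only
letters), NOT any printed statement and NOT NE2; nothing of Bałaban's is asserted; NE2 (U1a) NOT PROVED; spine PROVED 0/9 unchanged; NOT continuum YM / infinite volume / mass gap /
Clay.  HONEST DEPENDENCY: continuum YM on T⁴ ⇐ BetaPertH ∧ nine spine estimates (0/9 proved); BetaPertH ⇐ (D1) ∧ (D4) ∧ CAP+tail; G-an2-4 gates asym, D1 and NE2/3/4.  No `sorry`.
-/

noncomputable section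

open scoped BigOperators ComplexConjugate Matrix Matrix.Norms.L2Operator Kronecker

namespace Summit.QuantumFields.BalabanUV.T4Continuum.NE2.CovariantTableBalabanSupNoGo

open Literature.MathematicalPhysics.QuantumFieldTheory.Balaban1983to89.B5Prop11Plancherel (Tor fine)
open Literature.MathematicalPhysics.QuantumFieldTheory.Balaban1983to89.B5G183RateUnitTower (lev lev_neZero)
open Summit.QuantumFields.BalabanUV.T4Continuum.BalabanAveragedTowerUnit (idx)
open Summit.QuantumFields.BalabanUV.T4Continuum.CovariantBlockAveraging (transport)
open Summit.QuantumFields.BalabanUV.T4Continuum.LineAveragingPairing (glue)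
open Summit.QuantumFields.BalabanUV.T4Continuum.NE2.CovariantTableBalaban (lpt contourFrom length_contourFrom digit coordAt stepT TBal)
open Summit.QuantumFields.BalabanUV.T4Continuum.NE2.CovariantTableBalabanTwoLevel (TBal_succ digit_succ_glue digit_zero_glue digit_succ_div digit_zero mul_add_div_pow_succ)

variable {d : ℕ} (L : ℕ) [NeZero L] (M : Fin d → ℕ) [hM : ∀ μ, NeZero (M μ)] {o : Type*} [Fintype o] [DecidableEq o]

/-! ## §1 Constant abelian data: transports are powers -/

omit hM in
/-- transport of a CONSTANT scalar field `u·1` along a bond list of length `ℓ` is `u^ℓ·1`. [folklore] -/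
theorem transport_const {Nf : Fin d → ℕ} [∀ μ, NeZero (Nf μ)] (u : ℂ) (μ : Fin d) (Γ : List (Tor Nf × Fin d)) :
    transport Nf (fun _ _ => u • (1 : Matrix o o ℂ)) μ Γ = (u ^ Γ.length) • (1 : Matrix o o ℂ) := by
  rw [transport]
  induction Γ with
  | nil => simp
  | cons b Γ ih => rw [List.map_cons, List.prod_cons, ih, List.length_cons, pow_succ, Matrix.smul_mul, Matrix.one_mul, smul_smul, mul_comm]

/-- the steps of the composed table for constant data: `stepT = u_i^{Σ_ν digit_{k−i}(j_ν) + digit_{k−i}(t)}·1`. [folklore] -/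
theorem stepT_const (u : ℕ → ℂ) (k : ℕ) (y : Tor M) (j : Fin d → ℕ) (μ : Fin d) (t i : ℕ) :
    stepT L M (fun i _ _ => u i • (1 : Matrix o o ℂ)) k y j μ t i = (u i ^ ((∑ ν, digit L (k - i) (j ν)) + digit L (k - i) t)) • (1 : Matrix o o ℂ) := by
  haveI := lev_neZero L i
  rw [stepT, transport_const, length_contourFrom]

omit hM in
/-- products of scalar multiples of the identity. [folklore] -/
theorem prod_map_smul_one (l : List ℕ) (f : ℕ → ℂ) : (l.map fun i => f i • (1 : Matrix o o ℂ)).prod = (l.map f).prod • (1 : Matrix o o ℂ) := by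
  induction l with
  | nil => simp
  | cons a l ih => rw [List.map_cons, List.prod_cons, ih, List.map_cons, List.prod_cons, Matrix.smul_mul, Matrix.one_mul, smul_smul]

/-- the composed table for constant data: `TBal = (Π_{i=1}^{k} u_i^{ℓ_i})·1`, `ℓ_i = Σ_ν digit_{k−i}(j_ν) + digit_{k−i}(t)`. [folklore] -/
theorem TBal_const (u : ℕ → ℂ) (k : ℕ) (y : Tor M) (j : Fin d → Fin (lev L k)) (μ : Fin d) (t : ℕ) :
    TBal L M (fun i _ _ => u i • (1 : Matrix o o ℂ)) k y j μ t
      = (((List.range k).map fun i' => u (i' + 1) ^ ((∑ ν, digit L (k - (i' + 1)) (j ν : ℕ)) + digit L (k - (i' + 1)) t)).prod) • (1 : Matrix o o ℂ) := by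
  rw [TBal]
  have h : ((List.range k).map fun i' => stepT L M (fun i _ _ => u i • (1 : Matrix o o ℂ)) k y (fun ν => (j ν : ℕ)) μ t (i' + 1))
      = (List.range k).map fun i' => (u (i' + 1) ^ ((∑ ν, digit L (k - (i' + 1)) (j ν : ℕ)) + digit L (k - (i' + 1)) t)) • (1 : Matrix o o ℂ) :=
    List.map_congr_left fun i' _ => stepT_const L M u k y _ μ t (i' + 1)
  rw [h, prod_map_smul_one]

/-! ## §2 Digits of the witness positions `L^{k−1} − 1` and `L^{k−1}` -/

omit [NeZero L] in
/-- `L^q − 1 ≡ L − 1 (mod L)` for `q ≥ 1`, `L ≥ 1`. [folklore] -/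
theorem pow_sub_one_mod (hL : 1 ≤ L) {q : ℕ} (hq : 1 ≤ q) : (L ^ q - 1) % L = L - 1 := by
  obtain ⟨q', rfl⟩ := Nat.exists_eq_add_of_le' hq
  have hP : 1 ≤ L ^ q' := Nat.one_le_pow _ _ (by omega)
  have hLP : L ≤ L * L ^ q' := Nat.le_mul_of_pos_right L hP
  have h2 : L * (L ^ q' - 1) = L * L ^ q' - L := Nat.mul_sub_one L (L ^ q')
  have e : L ^ (q' + 1) - 1 = L * (L ^ q' - 1) + (L - 1) := by rw [pow_succ', h2]; omega
  rw [e, Nat.mul_add_mod, Nat.mod_eq_of_lt (by omega)]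

omit [NeZero L] in
/-- `(L^p − 1)/L^m = L^{p−m} − 1` for `m ≤ p`, `L ≥ 1`. [folklore] -/
theorem pow_sub_one_div (hL : 1 ≤ L) {m p : ℕ} (hm : m ≤ p) : (L ^ p - 1) / L ^ m = L ^ (p - m) - 1 := by
  obtain ⟨q, rfl⟩ := Nat.exists_eq_add_of_le hm
  have hLm : 0 < L ^ m := by positivity
  have h1 : 1 ≤ L ^ q := Nat.one_le_pow _ _ (by omega)
  rw [Nat.add_sub_cancel_left, pow_add]
  have hle : L ^ m ≤ L ^ m * L ^ q := Nat.le_mul_of_pos_right _ (by omega)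
  have h2 : L ^ m * (L ^ q - 1) = L ^ m * L ^ q - L ^ m := Nat.mul_sub_one (L ^ m) (L ^ q)
  have e : L ^ m * L ^ q - 1 = L ^ m * (L ^ q - 1) + (L ^ m - 1) := by rw [h2]; omega
  rw [e, Nat.mul_add_div hLm, Nat.div_eq_of_lt (by omega), add_zero]

omit [NeZero L] in
/-- digits of `L^{k−1} − 1` at the positions `k − i`, `2 ≤ i ≤ k`: all `L − 1`. [folklore] -/
theorem digit_witness_fine (hL : 1 ≤ L) {k i : ℕ} (hi : 2 ≤ i) (hik : i ≤ k) : digit L (k - i) (L ^ (k - 1) - 1) = L - 1 := by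
  unfold digit
  rw [pow_sub_one_div L hL (by omega), pow_sub_one_mod L hL (by omega)]

omit [NeZero L] in
/-- the digit of `L^{k−1} − 1` at the position `k − 1` (level `1`): `0`. [folklore] -/
theorem digit_witness_fine_top (hL : 1 ≤ L) (k : ℕ) : digit L (k - 1) (L ^ (k - 1) - 1) = 0 := by
  unfold digit
  rw [Nat.div_eq_of_lt (Nat.sub_lt (by positivity) Nat.one_pos), Nat.zero_mod]

omit [NeZero L] in
/-- digits of `L^{k−1}` at the positions `k − i`: `1` at `i = 1`, `0` for `2 ≤ i ≤ k` (`L ≥ 2`). [folklore] -/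
theorem digit_witness_coarse (hL : 2 ≤ L) {k i : ℕ} (hi : 1 ≤ i) (hik : i ≤ k) : digit L (k - i) (L ^ (k - 1)) = if i = 1 then 1 else 0 := by
  unfold digit
  have hLpos : 0 < L := by omega
  rw [Nat.pow_div (by omega) hLpos, show k - 1 - (k - i) = i - 1 by omega]
  split_ifs with h
  · subst h; simp [Nat.mod_eq_of_lt (by omega : 1 < L)]
  · obtain ⟨q, hq⟩ := Nat.exists_eq_add_of_le' (by omega : 1 ≤ i - 1)
    rw [hq, pow_succ, Nat.mul_mod_left]

/-! ## §3 The witness and its two-level defect -/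

/-- the sign pattern of the data: `−1` on level `1`, `+1` elsewhere. [folklore] -/
def sgn1 (i : ℕ) : ℝ := if i = 1 then -1 else 1

/-- **THE CONSTANT ABELIAN DATA** `W_i ≡ exp(i·ε_i·φ·L^{−i})·1`: contractive, every plaquette trivial, `‖W_i − 1‖ ≤ φ·L^{−i}`, and the SAME for the two problems (perfect consistency);
only AXIALLY inconsistent between level `1` and the finer levels. [folklore] -/
def phase (L : ℕ) (φ : ℝ) (i : ℕ) : ℂ := Complex.exp (Complex.I * ((sgn1 i * φ * ((L : ℝ)⁻¹) ^ i : ℝ) : ℂ))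

/-- the data as a tower of (constant) bond fields. [folklore] -/
def phaseW (L : ℕ) (M : Fin d → ℕ) (o : Type*) [DecidableEq o] (φ : ℝ) (i : ℕ) : Fin d → (idx L M i → Matrix o o ℂ) :=
  fun _ _ => phase L φ i • (1 : Matrix o o ℂ)

omit [NeZero L] hM in
/-- the data is CONTRACTIVE (`‖W_i‖ = 1·‖1‖ = 1`). [folklore] -/
theorem norm_phaseW_le [Nonempty o] (φ : ℝ) (i : ℕ) (ν : Fin d) (b : idx L M i) : ‖phaseW L M o φ i ν b‖ ≤ 1 := by
  unfold phaseW phase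
  rw [norm_smul, Complex.norm_exp_I_mul_ofReal, one_mul, norm_one]

omit [NeZero L] hM in
/-- the data has (3.35)-TYPE SIZES: `‖W_i − 1‖ ≤ |φ|·L^{−i}`. [folklore] -/
theorem norm_phaseW_sub_one_le [Nonempty o] (φ : ℝ) (i : ℕ) (ν : Fin d) (b : idx L M i) : ‖phaseW L M o φ i ν b - 1‖ ≤ |φ| * ((L : ℝ)⁻¹) ^ i := by
  unfold phaseW phase
  have e : Complex.exp (Complex.I * ((sgn1 i * φ * ((L : ℝ)⁻¹) ^ i : ℝ) : ℂ)) • (1 : Matrix o o ℂ) - 1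
      = (Complex.exp (Complex.I * ((sgn1 i * φ * ((L : ℝ)⁻¹) ^ i : ℝ) : ℂ)) - 1) • (1 : Matrix o o ℂ) := by rw [sub_smul, one_smul]
  rw [e, norm_smul, norm_one, mul_one]
  have h2 := Real.norm_exp_I_mul_ofReal_sub_one_le (x := sgn1 i * φ * ((L : ℝ)⁻¹) ^ i)
  have h3 : ‖sgn1 i * φ * ((L : ℝ)⁻¹) ^ i‖ = |φ| * ((L : ℝ)⁻¹) ^ i := by
    have hLi : 0 ≤ ((L : ℝ)⁻¹) ^ i := pow_nonneg (inv_nonneg.mpr (Nat.cast_nonneg L)) i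
    rw [Real.norm_eq_abs, abs_mul, abs_mul, abs_of_nonneg hLi]
    unfold sgn1; split_ifs <;> simp
  rw [h3] at h2
  exact h2

/-- the witness sub-block offset: `L − 1` in direction `μ`, `0` elsewhere. [folklore] -/
def rStar (L : ℕ) [NeZero L] (μ : Fin d) : Fin d → Fin L := fun ν => if ν = μ then ⟨L - 1, Nat.sub_lt (Nat.pos_of_ne_zero (NeZero.ne L)) Nat.one_pos⟩ else 0

/-- **THE TWO CHAINS OF THE WITNESS, EVALUATED**: for `k ≥ 2`, `L ≥ 2`, `j = 0`, `r = rStar μ`, `t′ = L·(L^{k−1} − 1) + 1` (an IN-RANGE fine position, carry depth `k − 1`):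
the level-`(k+1)` chain is `(Π_{i=2}^{k} u_i^{L−1})·u_{k+1}^{L}·1` and the level-`k` chain of the geometric parent `(0, L^{k−1})` is `u_1·1`. [folklore] -/
theorem TBal_witness_eq (hL : 2 ≤ L) (u : ℕ → ℂ) {k : ℕ} (hk : 2 ≤ k) (y : Tor M) (μ : Fin d) :
    TBal L M (fun i _ _ => u i • (1 : Matrix o o ℂ)) (k + 1) y (glue (lev L k) L ((fun _ => (0 : Fin (lev L k))), rStar L μ)) μ (L * (L ^ (k - 1) - 1) + 1)
        = ((((List.range k).map fun i' => u (i' + 1) ^ (if i' = 0 then 0 else L - 1)).prod) * u (k + 1) ^ L) • (1 : Matrix o o ℂ)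
      ∧ TBal L M (fun i _ _ => u i • (1 : Matrix o o ℂ)) k y (fun _ => (0 : Fin (lev L k))) μ (((((rStar L μ) μ : Fin L) : ℕ) + (L * (L ^ (k - 1) - 1) + 1)) / L)
        = u 1 • (1 : Matrix o o ℂ) := by
  haveI := lev_neZero L k
  have hL0 : 0 < L := by omega
  have hL1 : 1 ≤ L := by omega
  have ht0 : (L * (L ^ (k - 1) - 1) + 1) / L = L ^ (k - 1) - 1 := by rw [Nat.mul_add_div hL0, Nat.div_eq_of_lt (by omega : 1 < L), add_zero]
  have hrμ : (((rStar L μ) μ : Fin L) : ℕ) = L - 1 := by simp [rStar]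
  have ht1 : ((((rStar L μ) μ : Fin L) : ℕ) + (L * (L ^ (k - 1) - 1) + 1)) / L = L ^ (k - 1) := by
    rw [hrμ]
    have hp : 1 ≤ L ^ (k - 1) := Nat.one_le_pow _ _ hL0
    have e : L - 1 + (L * (L ^ (k - 1) - 1) + 1) = L * L ^ (k - 1) := by
      rw [Nat.mul_sub, mul_one]
      have : L ≤ L * L ^ (k - 1) := Nat.le_mul_of_pos_right _ (by omega)
      omega
    rw [e, Nat.mul_div_cancel_left _ hL0]
  refine ⟨?_, ?_⟩
  · -- the fine chain: factorise, evaluate the prefix and the finest step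
    rw [TBal_succ, ht0, TBal_const, stepT_const, smul_mul_smul, Matrix.mul_one]
    congr 1
    have hpre : ((List.range k).map fun i' => u (i' + 1) ^ ((∑ ν : Fin d, digit L (k - (i' + 1)) (((fun _ => (0 : Fin (lev L k))) ν : Fin (lev L k)) : ℕ))
          + digit L (k - (i' + 1)) (L ^ (k - 1) - 1)))
        = (List.range k).map fun i' => u (i' + 1) ^ (if i' = 0 then 0 else L - 1) := by
      refine List.map_congr_left fun i' hi' => ?_
      rw [List.mem_range] at hi'
      have hz : ∑ ν : Fin d, digit L (k - (i' + 1)) (((fun _ => (0 : Fin (lev L k))) ν : Fin (lev L k)) : ℕ) = 0 := by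
        refine Finset.sum_eq_zero fun ν _ => ?_
        simp [digit]
      rw [hz, zero_add]
      congr 1
      split_ifs with h0
      · subst h0; exact digit_witness_fine_top L hL1 k
      · exact digit_witness_fine L hL1 (by omega) (by omega)
    have hfin : (∑ ν : Fin d, digit L (k + 1 - (k + 1)) (L * (((fun _ => (0 : Fin (lev L k))) ν : Fin (lev L k)) : ℕ) + ((rStar L μ ν : Fin L) : ℕ)))
          + digit L (k + 1 - (k + 1)) (L * (L ^ (k - 1) - 1) + 1) = L := by
      rw [Nat.sub_self]
      have hs : ∀ ν : Fin d, digit L 0 (L * (((fun _ => (0 : Fin (lev L k))) ν : Fin (lev L k)) : ℕ) + ((rStar L μ ν : Fin L) : ℕ)) = ((rStar L μ ν : Fin L) : ℕ) :=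
        fun ν => digit_zero_glue L _ _ (rStar L μ ν).isLt
      simp only [hs]
      rw [digit_zero_glue L _ _ (by omega : 1 < L), Finset.sum_eq_single μ]
      · rw [hrμ]; omega
      · intro ν _ hν; simp [rStar, hν]
      · intro h; exact absurd (Finset.mem_univ μ) h
    rw [hpre, hfin]
  · -- the coarse chain of the geometric parent
    rw [ht1, TBal_const]
    congr 1
    have hpre : ((List.range k).map fun i' => u (i' + 1) ^ ((∑ ν : Fin d, digit L (k - (i' + 1)) (((fun _ => (0 : Fin (lev L k))) ν : Fin (lev L k)) : ℕ))
          + digit L (k - (i' + 1)) (L ^ (k - 1))))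
        = (List.range k).map fun i' => if i' = 0 then u 1 else 1 := by
      refine List.map_congr_left fun i' hi' => ?_
      rw [List.mem_range] at hi'
      have hz : ∑ ν : Fin d, digit L (k - (i' + 1)) (((fun _ => (0 : Fin (lev L k))) ν : Fin (lev L k)) : ℕ) = 0 := by
        refine Finset.sum_eq_zero fun ν _ => ?_
        simp [digit]
      rw [hz, zero_add, digit_witness_coarse L hL (by omega) (by omega)]
      by_cases h0 : i' = 0
      · subst h0; simp
      · rw [if_neg (show ¬ (i' + 1 = 1) by omega), if_neg h0, pow_zero]
    rw [hpre]
    obtain ⟨k', rfl⟩ := Nat.exists_eq_add_of_le' (by omega : 1 ≤ k)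
    rw [List.range_succ_eq_map, List.map_cons, List.prod_cons, if_pos rfl, List.map_map]
    have h1 : ((List.range k').map ((fun i' => if i' = 0 then u 1 else (1 : ℂ)) ∘ Nat.succ)).prod = 1 := by
      rw [List.prod_eq_one]
      intro x hx
      obtain ⟨i, _, rfl⟩ := List.mem_map.mp hx
      simp
    rw [h1, mul_one]

omit [NeZero L] in
/-- the exponents of the fine chain add up: `Σ_{i'=1}^{k−1} (L−1)·φ·L^{−(i'+1)} + L·φ·L^{−(k+1)} = φ·L^{−1}` (`k ≥ 1`). [folklore] -/
theorem geom_phase_sum (hL : 2 ≤ L) (φ : ℝ) {k : ℕ} (hk : 1 ≤ k) :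
    (∑ i' ∈ Finset.range k, (if i' = 0 then (0 : ℝ) else ((L : ℝ) - 1) * (φ * ((L : ℝ)⁻¹) ^ (i' + 1))))
      + (L : ℝ) * (φ * ((L : ℝ)⁻¹) ^ (k + 1)) = φ * (L : ℝ)⁻¹ := by
  have hLr : (L : ℝ) ≠ 0 := by exact_mod_cast (by omega : L ≠ 0)
  obtain ⟨k', rfl⟩ := Nat.exists_eq_add_of_le' hk
  induction k' with
  | zero => simp; field_simp
  | succ k' ih =>
    rw [Finset.sum_range_succ, if_neg (by omega)]
    have e1 : (L : ℝ) * (φ * ((L : ℝ)⁻¹) ^ (k' + 1 + 1)) = φ * ((L : ℝ)⁻¹) ^ (k' + 1) := by rw [pow_succ]; field_simp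
    have e2 : (L : ℝ) * (φ * ((L : ℝ)⁻¹) ^ (k' + 1 + 1 + 1)) = φ * ((L : ℝ)⁻¹) ^ (k' + 1 + 1) := by rw [pow_succ]; field_simp
    have e3 : ((L : ℝ) - 1) * (φ * ((L : ℝ)⁻¹) ^ (k' + 1 + 1)) + φ * ((L : ℝ)⁻¹) ^ (k' + 1 + 1) = φ * ((L : ℝ)⁻¹) ^ (k' + 1) := by
      rw [pow_succ]; field_simp; ring
    have ih' := ih (by omega)
    rw [e1] at ih'
    rw [e2]
    linarith

omit [NeZero L] in
/-- the product of the phases of the fine chain: `(Π_{i=2}^{k} u_i^{L−1})·u_{k+1}^{L} = exp(iφ/L)` for `u_i = exp(iε_iφL^{−i})` (geometric sum `(L−1)Σ_{i=2}^{k}L^{−i} + L·L^{−(k+1)} = L^{−1}`). [folklore] -/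
theorem prod_phase_eq (hL : 2 ≤ L) (φ : ℝ) {k : ℕ} (hk : 1 ≤ k) :
    ((List.range k).map fun i' => phase L φ (i' + 1) ^ (if i' = 0 then 0 else L - 1)).prod * phase L φ (k + 1) ^ L
      = Complex.exp (Complex.I * ((φ * (L : ℝ)⁻¹ : ℝ) : ℂ)) := by
  have hLr : (L : ℝ) ≠ 0 := by exact_mod_cast (by omega : L ≠ 0)
  -- each factor is an exponential; collect the exponents
  have hfac : ∀ i' : ℕ, phase L φ (i' + 1) ^ (if i' = 0 then 0 else L - 1)
      = Complex.exp (Complex.I * (((if i' = 0 then (0 : ℝ) else ((L : ℝ) - 1) * (φ * ((L : ℝ)⁻¹) ^ (i' + 1))) : ℝ) : ℂ)) := by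
    intro i'
    split_ifs with h
    · simp
    · have hs : sgn1 (i' + 1) = 1 := by unfold sgn1; rw [if_neg (by omega)]
      rw [phase, hs, one_mul, ← Complex.exp_nat_mul]
      congr 1
      have : ((L - 1 : ℕ) : ℂ) = (L : ℂ) - 1 := by rw [Nat.cast_sub (by omega)]; simp
      rw [this]; push_cast; ring
  have hlast : phase L φ (k + 1) ^ L = Complex.exp (Complex.I * (((L : ℝ) * (φ * ((L : ℝ)⁻¹) ^ (k + 1))) : ℂ)) := by
    have hs : sgn1 (k + 1) = 1 := by unfold sgn1; rw [if_neg (by omega)]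
    rw [phase, hs, one_mul, ← Complex.exp_nat_mul]
    congr 1; push_cast; ring
  simp_rw [hfac]
  rw [hlast]
  -- turn the list product into a sum of exponents
  have hprod : ((List.range k).map fun i' => Complex.exp (Complex.I * (((if i' = 0 then (0 : ℝ) else ((L : ℝ) - 1) * (φ * ((L : ℝ)⁻¹) ^ (i' + 1))) : ℝ) : ℂ))).prod
      = Complex.exp (Complex.I * ((∑ i' ∈ Finset.range k, (if i' = 0 then (0 : ℝ) else ((L : ℝ) - 1) * (φ * ((L : ℝ)⁻¹) ^ (i' + 1))) : ℝ) : ℂ)) := by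
    rw [← List.prod_toFinset _ List.nodup_range, List.toFinset_range, ← Complex.exp_sum]
    congr 1
    push_cast
    rw [Finset.mul_sum]
  rw [hprod, ← Complex.exp_add]
  congr 1
  have hgeom := geom_phase_sum L hL φ hk
  rw [← mul_add]
  congr 1
  exact_mod_cast hgeom

/-- **THE IN-RANGE TWO-LEVEL DEFECT OF THE WITNESS IS `‖exp(2iφ/L) − 1‖`, INDEPENDENT OF `k`** (`k ≥ 2`, `L ≥ 2`). [folklore] -/
theorem TBal_sup_defect_eq [Nonempty o] (hL : 2 ≤ L) (φ : ℝ) {k : ℕ} (hk : 2 ≤ k) (y : Tor M) (μ : Fin d) :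
    ‖TBal L M (phaseW L M o φ) (k + 1) y (glue (lev L k) L ((fun _ => (0 : Fin (lev L k))), rStar L μ)) μ (L * (L ^ (k - 1) - 1) + 1)
        - TBal L M (phaseW L M o φ) k y (fun _ => (0 : Fin (lev L k))) μ (((((rStar L μ) μ : Fin L) : ℕ) + (L * (L ^ (k - 1) - 1) + 1)) / L)‖
      = ‖Complex.exp (Complex.I * ((2 * φ * (L : ℝ)⁻¹ : ℝ) : ℂ)) - 1‖ := by
  obtain ⟨h1, h2⟩ := TBal_witness_eq (o := o) L M hL (phase L φ) hk y μ
  have e1 : TBal L M (phaseW L M o φ) (k + 1) y (glue (lev L k) L ((fun _ => (0 : Fin (lev L k))), rStar L μ)) μ (L * (L ^ (k - 1) - 1) + 1)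
      = Complex.exp (Complex.I * ((φ * (L : ℝ)⁻¹ : ℝ) : ℂ)) • (1 : Matrix o o ℂ) := by
    rw [show phaseW L M o φ = fun (i : ℕ) (_ : Fin d) (_ : idx L M i) => phase L φ i • (1 : Matrix o o ℂ) from rfl, h1, prod_phase_eq L hL φ (by omega)]
  have e2 : TBal L M (phaseW L M o φ) k y (fun _ => (0 : Fin (lev L k))) μ (((((rStar L μ) μ : Fin L) : ℕ) + (L * (L ^ (k - 1) - 1) + 1)) / L)
      = Complex.exp (Complex.I * ((-(φ * (L : ℝ)⁻¹) : ℝ) : ℂ)) • (1 : Matrix o o ℂ) := by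
    rw [show phaseW L M o φ = fun (i : ℕ) (_ : Fin d) (_ : idx L M i) => phase L φ i • (1 : Matrix o o ℂ) from rfl, h2, phase]
    congr 2
    unfold sgn1; rw [if_pos rfl]; push_cast; ring
  rw [e1, e2, ← sub_smul, norm_smul, norm_one, mul_one]
  -- `‖e^{ia} − e^{−ia}‖ = ‖e^{2ia} − 1‖`
  have hfac : Complex.exp (Complex.I * ((φ * (L : ℝ)⁻¹ : ℝ) : ℂ)) - Complex.exp (Complex.I * ((-(φ * (L : ℝ)⁻¹) : ℝ) : ℂ))
      = Complex.exp (Complex.I * ((-(φ * (L : ℝ)⁻¹) : ℝ) : ℂ)) * (Complex.exp (Complex.I * ((2 * φ * (L : ℝ)⁻¹ : ℝ) : ℂ)) - 1) := by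
    rw [mul_sub, mul_one, ← Complex.exp_add]
    congr 2
    push_cast; ring
  rw [hfac, norm_mul, Complex.norm_exp_I_mul_ofReal, one_mul]

/-- **THE SUP-FORM TWO-LEVEL CONSISTENCY FAILS FOR THE COMPOSED TABLE AT EVERY GEOMETRIC RATE** (`L ≥ 2`, `0 < φ < πL`, any unit torus, any colour space): there is NO `θ₀` with
`‖TBal W (k+1) y (L·j+r) μ t′ − TBal W k y j μ ⌊(r_μ+t′)/L⌋‖ ≤ θ₀·L^{−k}` for all `k` and all in-range `(j, r, t′)`, although the data `W = phaseW φ` is contractive, has sizes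
`‖W_i − 1‖ ≤ φL^{−i}`, trivial plaquettes, and is the same for the two problems.  (The MEAN over the line position IS geometric up to `(k+1)`: files 3–5.) [folklore] -/
theorem not_sup_consistency_TBal [Nonempty o] (hL : 2 ≤ L) {φ : ℝ} (hφ : 0 < φ) (hφL : φ < Real.pi * L) (y : Tor M) (μ : Fin d) :
    ¬ ∃ θ₀ : ℝ, ∀ (k : ℕ) (j : Fin d → Fin (lev L k)) (r : Fin d → Fin L) (t' : ℕ), t' < L * lev L k →
      ‖TBal L M (phaseW L M o φ) (k + 1) y (glue (lev L k) L (j, r)) μ t' - TBal L M (phaseW L M o φ) k y j μ (((r μ : ℕ) + t') / L)‖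
        ≤ θ₀ * ((L : ℝ)⁻¹) ^ k := by
  rintro ⟨θ₀, hθ⟩
  have hLr : (1 : ℝ) < L := by exact_mod_cast (by omega : 1 < L)
  have hL0 : (0 : ℝ) < L := by linarith
  -- the defect is a fixed positive number
  set δ : ℝ := ‖Complex.exp (Complex.I * ((2 * φ * (L : ℝ)⁻¹ : ℝ) : ℂ)) - 1‖ with hδ
  have hδpos : 0 < δ := by
    rw [hδ, norm_pos_iff, sub_ne_zero]
    intro h
    obtain ⟨n, hn⟩ := Complex.exp_eq_one_iff.mp h
    have h2 : ((2 * φ * (L : ℝ)⁻¹ : ℝ) : ℂ) = (((n : ℝ) * (2 * Real.pi) : ℝ) : ℂ) := by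
      apply mul_left_cancel₀ Complex.I_ne_zero
      rw [hn]; push_cast; ring
    have him : 2 * φ * (L : ℝ)⁻¹ = (n : ℝ) * (2 * Real.pi) := by exact_mod_cast h2
    have hx0 : 0 < 2 * φ * (L : ℝ)⁻¹ := by positivity
    have hx1 : 2 * φ * (L : ℝ)⁻¹ < 2 * Real.pi := by
      rw [show 2 * φ * (L : ℝ)⁻¹ = 2 * (φ / L) by ring]
      have : φ / L < Real.pi := (div_lt_iff₀ hL0).mpr hφL
      linarith
    rcases le_or_gt n 0 with hn0 | hn0
    · have : (n : ℝ) ≤ 0 := by exact_mod_cast hn0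
      nlinarith [Real.pi_pos]
    · have : (1 : ℝ) ≤ n := by exact_mod_cast hn0
      nlinarith [Real.pi_pos]
  -- pick `k ≥ 2` with `(|θ₀| + 1)·L^{−k} < δ`
  have hA : (0 : ℝ) < |θ₀| + 1 := by positivity
  obtain ⟨k₁, hk₁⟩ := exists_pow_lt_of_lt_one (div_pos hδpos hA) (inv_lt_one_of_one_lt₀ hLr)
  set k := max k₁ 2 with hk
  have hk2 : 2 ≤ k := le_max_right _ _
  have hy0 : (0 : ℝ) ≤ (L : ℝ)⁻¹ := inv_nonneg.mpr hL0.le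
  have hpow : ((L : ℝ)⁻¹) ^ k ≤ ((L : ℝ)⁻¹) ^ k₁ := pow_le_pow_of_le_one hy0 (inv_le_one_of_one_le₀ hLr.le) (le_max_left _ _)
  -- the witness is in range
  haveI := lev_neZero L k
  have hrange : L * (L ^ (k - 1) - 1) + 1 < L * lev L k := by
    have hlev : lev L k = L ^ k := by have h := cast_lev' (L := L) k; exact_mod_cast h
    rw [hlev]
    have hP : 1 ≤ L ^ (k - 1) := Nat.one_le_pow _ _ (by omega)
    have hLP : L ≤ L * L ^ (k - 1) := Nat.le_mul_of_pos_right L hP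
    have h2 : L * (L ^ (k - 1) - 1) = L * L ^ (k - 1) - L := Nat.mul_sub_one L (L ^ (k - 1))
    have hk' : L * L ^ (k - 1) = L ^ k := by rw [← pow_succ']; congr 1; omega
    have hkk : L ^ k < L * L ^ k := by
      have : 1 * L ^ k < L * L ^ k := Nat.mul_lt_mul_of_pos_right (by omega) (by positivity)
      simpa using this
    omega
  have h := hθ k (fun _ => 0) (rStar L μ) (L * (L ^ (k - 1) - 1) + 1) hrange
  rw [TBal_sup_defect_eq L M hL φ hk2 y μ] at h
  have h3 : θ₀ * ((L : ℝ)⁻¹) ^ k ≤ |θ₀| * ((L : ℝ)⁻¹) ^ k₁ :=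
    (mul_le_mul_of_nonneg_right (le_abs_self θ₀) (pow_nonneg hy0 k)).trans (mul_le_mul_of_nonneg_left hpow (abs_nonneg θ₀))
  have h4 : ((L : ℝ)⁻¹) ^ k₁ * (|θ₀| + 1) < δ := (lt_div_iff₀ hA).mp hk₁
  nlinarith [abs_nonneg θ₀, pow_nonneg hy0 k₁]
where
  /-- the level factor as a real power (local copy of the tree's `cast_lev'` statement, by name). -/
  cast_lev' {L : ℕ} (k : ℕ) : ((lev L k : ℕ) : ℝ) = (L : ℝ) ^ k := BalabanAveragedTowerUnit.cast_lev' (L := L) k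

end Summit.QuantumFields.BalabanUV.T4Continuum.NE2.CovariantTableBalabanSupNoGo

end
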